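import Literature.AlgebraicGeometry.ModuliOfAbelianVarieties.SiegelAdelicMarkingTorusPresentation
import Literature.AlgebraicGeometry.ModuliOfAbelianVarieties.SiegelPrincipalLevelNormal
import Literature.AlgebraicGeometry.ModuliOfAbelianVarieties.SiegelFamilyRepresentsAbelianVarieties
import Literature.AlgebraicGeometry.HodgeTheory.AbelianVarietyHodgeFullnessHolds
import Literature.AlgebraicGeometry.HodgeTheory.ComplexTorusProjectiveRiemannForm
import Literature.NumberTheory.Transcendental.AbelianVarietyAnalyticLieGroup
import HarnessLib

/-!
# Every complex abelian variety is marked by some `[J(Z), r]` ([Milne 2005] Thm. 6.11, surjectivity; [Lange 2023] Thm. 3.1.2)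

Topic `Literature/AlgebraicGeometry/ModuliOfAbelianVarieties`; namespace `Literature.AlgebraicGeometry.ModuliOfAbelianVarieties`.
Cell hodgecm-mathlib (D-0151), U-DAG node U-b / brick B4 leaf (a) (B-plan1 R49): the SURJECTIVITY heart of «the set `Sh_K(ℂ)`
classifies the triples `(A, s, ηK)`» on the abelian-variety side, in the currency of ★ T1′ `SiegelAdelicMarking`:
* `exists_siegelAdelicMarking_of_addEquiv` — a complex abelian variety `A` with a torus uniformisation
  `φ : E/Φ(ℤ^ι) → A(ℂ)` (★ `IsAnalytification`, additive) and a biholomorphic group isomorphism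
  `h : X^δ_Z = ℂ^g/(Z, Δ)ℤ^{2g} ≃ E/Φ(ℤ^ι)` (`Z ∈ 𝔥_g`) is MARKED by `[J(Z), r]` for EVERY integral representative
  `r ∈ K_δ(1) = GSp_δ(ℤ̂)`, with lattice basis `γ = 1`, complex coordinates the Siegel period isomorphism `Φ_Z`, and
  uniformisation `φ ∘ h` (so `u(v) = φ(h[ṽ])`);
* `nonempty_siegelAdelicMarking_of_isIsomorphic` — the same from ★ `ComplexTorus.IsIsomorphic`;
* `exists_siegelAdelicMarking` — EVERY complex abelian variety is marked by some `[J(Z), r]`, any `r ∈ K_δ(1)`, for the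
  polarisation type `δ` and period point `Z ∈ 𝔥_g` of a Siegel normal form (★ `complexAbelianVariety_torusUniformised_holds`
  + ★ `complexAbelianVariety_torus_isAbelianVariety` + ★ `ComplexTorus.IsAbelianVariety.exists_isIsomorphic_siegelPeriodEquiv`).
THEOREMS ONLY (no definition, no named fact, no instance, no `sorry`).  HC_CM is proved only modulo the printed citations until
rung 0 closes.

## References
* [Milne2005ShimuraVarieties] J. S. Milne, *Introduction to Shimura Varieties* (2005), §6 Thm. 6.11 pp. 74–75 (and its proof:
  «choose an isomorphism `a : H₁(A, ℤ) → V(ℤ)` …»).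
* [Lange2023AbelianVarietiesComplex] H. Lange, *Abelian Varieties over the Complex Numbers* (2023), §3.1.1 Prop. 3.1.1 / Thm. 3.1.2,
  §7.1.2 Lemma 7.1.5–7.1.6.
* [LangeBirkenhake1992] H. Lange, Ch. Birkenhake, *Complex Abelian Varieties* (1992), §8.1.
-/

set_option autoImplicit false

noncomputable section

open Matrix CategoryTheory AlgebraicGeometry NumberField IsDedekindDomain
open scoped Manifold ContDiff
open Literature.AlgebraicGeometry.Motives (AbelianVariety AlgPoints ComplexPoints)
open Literature.Geometry.Kaehler (ComplexTorus)
open Literature.NumberTheory.Transcendental (IsAnalytification)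
open Literature.NumberTheory.Automorphic (siegelUpperHalfSpace)
open Literature.AlgebraicGeometry.HodgeTheory (complexAbelianVariety_torusUniformised_holds
  complexAbelianVariety_torus_isAbelianVariety)

namespace Literature.AlgebraicGeometry.ModuliOfAbelianVarieties

open SiegelModuli

variable {g : ℕ} {δ : Fin g → ℕ}

/-- For an integral representative `r ∈ K_δ(1) = GSp_δ(ℤ̂)` the STANDARD lattice is a lattice of `[r]`: `γ = 1` is a basis
matrix of `Λ_r = ℚ^{2g} ∩ r·ℤ̂^{2g} = ℤ^{2g}` (`r, r⁻¹` have integral entries). [cite: Milne2005ShimuraVarieties, §4 pp. 48–49 and §6 p. 75] -/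
theorem isLatticeBasis_one_of_mem_principalLevelSubgroup_one {r : gspFinAdelic δ} (hr : r ∈ principalLevelSubgroup δ 1) :
    IsLatticeBasis r (1 : GL (Fin g ⊕ Fin g) ℚ) := by
  intro i j
  have h1 : adelicMatrix (((1 : GL (Fin g ⊕ Fin g) ℚ)⁻¹ : GL (Fin g ⊕ Fin g) ℚ) :
      Matrix (Fin g ⊕ Fin g) (Fin g ⊕ Fin g) ℚ) = 1 := by
    rw [inv_one, Units.val_one]; exact Matrix.map_one _ (map_zero _) (map_one _)
  have h2 : adelicMatrix (((1 : GL (Fin g ⊕ Fin g) ℚ)) : Matrix (Fin g ⊕ Fin g) (Fin g ⊕ Fin g) ℚ) = 1 := by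
    rw [Units.val_one]; exact Matrix.map_one _ (map_zero _) (map_one _)
  rw [h1, h2, Matrix.one_mul, Matrix.mul_one]
  exact ⟨isIntegral_of_isCongOne_one ((mem_principalLevelSubgroup_iff δ).1 hr).1 i j,
    isIntegral_of_isCongOne_one ((mem_principalLevelSubgroup_iff δ).1 hr).2 i j⟩

/-- **A torus-uniformised complex abelian variety with a Siegel presentation is marked by `[J(Z), r]` for every integral
`r`.**  Given `φ : E/Φ(ℤ^ι) → A(ℂ)` an additive analytification of the complex abelian variety `A`, a point `Z ∈ 𝔥_g`
(`g = dim A`), a biholomorphic group isomorphism `h : X^δ_Z ≃ E/Φ(ℤ^ι)` from the Siegel torus of type `δ` at `Z`, and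
`r ∈ K_δ(1)`: there is a T1′ marking `m` of `A` by `[J(Z), r]` with lattice basis `γ = 1`, coordinates `Ψ = Φ_Z` (the Siegel
period isomorphism), and uniformisation `φ ∘ h` — so `m.r v = φ (h [ṽ])`.  (Milne's proof of Thm. 6.11: «choose an
isomorphism `a : H₁(A, ℤ) → V(ℤ)` …»; the complex-structure clause is Lange's `Φ_Z ∘ J_Z = i·Φ_Z`, ★ `siegelPeriodMap_jOfSiegel_mulVec`.)
[cite: Milne2005ShimuraVarieties, §6 Thm. 6.11 pp. 74–75] [cite: Lange2023AbelianVarietiesComplex, §7.1.2 Lemma 7.1.5–7.1.6 (p0327)] -/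
theorem exists_siegelAdelicMarking_of_addEquiv {ι : Type} [Fintype ι] (A : AbelianVariety ℂ)
    {Φ : (ι → ℝ) ≃L[ℝ] (Fin A.dim → ℂ)} (φ : ComplexTorus Φ → A.Points ℂ)
    (hφ : IsAnalytification (Fin A.dim → ℂ) A.X A.dim φ) (hadd : ∀ x y, φ (x + y) = φ x * φ y)
    (hg : A.dim = g) (hδ : ∀ i, 0 < δ i) {Z : Matrix (Fin g) (Fin g) ℂ} (hZ : Z ∈ siegelUpperHalfSpace g)
    (h : ComplexTorus (siegelPeriodEquiv hδ hZ) ≃+ ComplexTorus Φ)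
    (hh : ContMDiff 𝓘(ℂ, Fin g → ℂ) 𝓘(ℂ, Fin A.dim → ℂ) ω h)
    (hh' : ContMDiff 𝓘(ℂ, Fin A.dim → ℂ) 𝓘(ℂ, Fin g → ℂ) ω h.symm)
    {r : gspFinAdelic δ} (hr : r ∈ principalLevelSubgroup δ 1) :
    ∃ m : SiegelAdelicMarking ⟨jOfSiegel δ Z, SiegelComplexRecordSystem.jOfSiegel_mem_C0pm hδ hZ⟩ r A,
      m.γ = 1 ∧ (∀ x, m.toFun x = φ (h x)) ∧
        ∀ v : Fin g ⊕ Fin g → ℚ, m.r v = φ (h (ComplexTorus.proj (siegelPeriodEquiv hδ hZ) fun i => (v i : ℝ))) := by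
  -- `φ ∘ h` is an analytification of `A` modelled on `ℂ^g`
  have hhomeo : IsHomeomorph (h : ComplexTorus (siegelPeriodEquiv hδ hZ) → ComplexTorus Φ) :=
    (Homeomorph.mk h.toEquiv hh.continuous hh'.continuous).isHomeomorph
  have hdim : Module.finrank ℂ (Fin g → ℂ) = Module.finrank ℂ (Fin A.dim → ℂ) := by rw [hg]
  have han : IsAnalytification (Fin g → ℂ) A.X A.dim (φ ∘ h) :=
    hφ.comp_of_isHomeomorph hhomeo (hh.mdifferentiable (by simp)) hdim
  refine ⟨{ γ := 1
            γ_isLatticeBasis := isLatticeBasis_one_of_mem_principalLevelSubgroup_one hr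
            Ψ := siegelPeriodEquiv hδ hZ
            Ψ_J := fun x => ?_
            toFun := φ ∘ h
            isAnalytification := han
            toFun_add := fun x y => by rw [Function.comp_apply, map_add, hadd]; rfl },
    rfl, fun x => rfl, fun v => ?_⟩
  · -- the complex-structure clause `Φ_Z (J_Z x) = i · Φ_Z x` (`γ = 1`)
    have h1 : (((1 : GL (Fin g ⊕ Fin g) ℚ)⁻¹ : GL (Fin g ⊕ Fin g) ℚ) : Matrix (Fin g ⊕ Fin g) (Fin g ⊕ Fin g) ℚ).map
        (algebraMap ℚ ℝ) = 1 := by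
      rw [inv_one, Units.val_one]; exact Matrix.map_one _ (map_zero _) (map_one _)
    rw [h1, Matrix.one_mulVec, Matrix.one_mulVec, siegelPeriodEquiv_apply, siegelPeriodEquiv_apply]
    exact siegelPeriodMap_jOfSiegel_mulVec hδ hZ x
  · -- `u(v) = φ (h [ṽ])`
    rw [SiegelAdelicMarking.r_def]
    simp only [inv_one, Units.val_one, Matrix.one_mulVec, Function.comp_apply]

/-- **The same from an abstract isomorphism of complex tori** (★ `ComplexTorus.IsIsomorphic`): a torus-uniformised complex
abelian variety whose torus is isomorphic to the Siegel torus `X^δ_Z` is marked by `[J(Z), r]` for every `r ∈ K_δ(1)`.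
[cite: Milne2005ShimuraVarieties, §6 Thm. 6.11 pp. 74–75] [cite: Lange2023AbelianVarietiesComplex, §3.1.1 Thm. 3.1.2] -/
theorem nonempty_siegelAdelicMarking_of_isIsomorphic {ι : Type} [Fintype ι] (A : AbelianVariety ℂ)
    {Φ : (ι → ℝ) ≃L[ℝ] (Fin A.dim → ℂ)} (φ : ComplexTorus Φ → A.Points ℂ)
    (hφ : IsAnalytification (Fin A.dim → ℂ) A.X A.dim φ) (hadd : ∀ x y, φ (x + y) = φ x * φ y)
    (hg : A.dim = g) (hδ : ∀ i, 0 < δ i) {Z : Matrix (Fin g) (Fin g) ℂ} (hZ : Z ∈ siegelUpperHalfSpace g)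
    (e : ComplexTorus.IsIsomorphic Φ (siegelPeriodEquiv hδ hZ))
    {r : gspFinAdelic δ} (hr : r ∈ principalLevelSubgroup δ 1) :
    Nonempty (SiegelAdelicMarking ⟨jOfSiegel δ Z, SiegelComplexRecordSystem.jOfSiegel_mem_C0pm hδ hZ⟩ r A) := by
  obtain ⟨h, hh, hh'⟩ := e.symm
  obtain ⟨m, -⟩ := exists_siegelAdelicMarking_of_addEquiv A φ hφ hadd hg hδ hZ h hh hh' hr
  exact ⟨m⟩

/-- **EVERY COMPLEX ABELIAN VARIETY IS MARKED BY SOME `[J(Z), r]`** ([Milne 2005, Thm. 6.11], surjectivity on the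
abelian-variety side; [Lange 2023, Thm. 3.1.2]): for a complex abelian variety `A` there are a polarisation type `δ` on
`g = dim A` letters and a period point `Z ∈ 𝔥_g` such that `A` is marked by `[J(Z), r]` for EVERY integral representative
`r ∈ K_δ(1)`.  Proof: `A(ℂ)` is a complex torus (★ `complexAbelianVariety_torusUniformised_holds`), which is polarisable
(★ `complexAbelianVariety_torus_isAbelianVariety`, Lefschetz/Riemann), hence isomorphic to a Siegel torus `X^δ_Z`
(★ `ComplexTorus.IsAbelianVariety.exists_isIsomorphic_siegelPeriodEquiv`, Frobenius + Siegel normal form).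
[cite: Milne2005ShimuraVarieties, §6 Thm. 6.11 pp. 74–75] [cite: Lange2023AbelianVarietiesComplex, §3.1.1 Prop. 3.1.1 and Thm. 3.1.2]
[cite: LangeBirkenhake1992, §8.1] -/
theorem exists_siegelAdelicMarking (A : AbelianVariety ℂ) :
    ∃ (g : ℕ) (δ : Fin g → ℕ) (hδ : IsPolarizationType δ) (Z : Matrix (Fin g) (Fin g) ℂ) (hZ : Z ∈ siegelUpperHalfSpace g),
      A.dim = g ∧ ∀ r : gspFinAdelic δ, r ∈ principalLevelSubgroup δ 1 →
        Nonempty (SiegelAdelicMarking ⟨jOfSiegel δ Z, SiegelComplexRecordSystem.jOfSiegel_mem_C0pm hδ.1 hZ⟩ r A) := by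
  classical
  obtain ⟨ι, _, _, Φ, φ, hφ, hadd⟩ := complexAbelianVariety_torusUniformised_holds A
  have hX : ComplexTorus.IsAbelianVariety Φ := complexAbelianVariety_torus_isAbelianVariety A ι Φ φ hφ
  obtain ⟨g, δ, hδ, Z, hchain, hdim, hiso⟩ := hX.exists_isIsomorphic_siegelPeriodEquiv
  have hg : A.dim = g := by
    rw [Module.finrank_fintype_fun_eq_card, Fintype.card_fin] at hdim
    exact hdim
  exact ⟨g, δ, ⟨hδ, hchain⟩, Z, Z.2, hg, fun r hr => nonempty_siegelAdelicMarking_of_isIsomorphic A φ hφ hadd hg hδ Z.2 hiso hr⟩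

end Literature.AlgebraicGeometry.ModuliOfAbelianVarieties

end
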